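import Literature.NumberTheory.Automorphic.AutomorphicRepsGLSatakeScalars
import Literature.NumberTheory.Automorphic.HeckeUnramifiedLevelLocal
import Literature.NumberTheory.Automorphic.UnramifiedLevelChange
import Literature.NumberTheory.Automorphic.AutomorphicTwistHecke
import Literature.NumberTheory.Automorphic.LocalComponentBJExistsProofs
import Literature.NumberTheory.Automorphic.CuspidalCohomologyGLRankOneCharacter
import HarnessLib

/-!
# The sum of local translations on `K(𝔫)`-invariant automorphic forms is the classical Hecke
# operator, and acts by the Satake eigenvalue modulo `W'`

Topic `NumberTheory/Automorphic`; namespaces `Literature.NumberTheory.Automorphic.AutomorphicRepData`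
and `…Automorphic` (one lemma on `BigHeckeGLn.heckeElement`).  Theorems only (no definition, no
named fact, no `sorry`).

Forms-side half of the identification of Hecke eigenvalues of cohomology classes of an automorphic
representation `π = W / W'` of `GL_n(𝔸_K)` (Borel–Jacquet model, `AutomorphicRepData`) with Satake
parameters (Eichler–Shimura–Harder glue, Harder 1987, §3):

* `map_ofFinite_comap_principalCongruenceLevel` — `GLn.ofFinite (K_f(𝔫)) = K(𝔫)`;
  `mem_fixedPoints_comp_ofFinite`;
* `sum_rightTranslation_ofLocal_eq_heckeOperator` — for `𝔫 ≠ 0`, `w ∤ 𝔫`, `t ∈ GL_n(F_w)`, a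
  transversal `s` of `GL_n(𝒪_w) t GL_n(𝒪_w) / GL_n(𝒪_w)` and a `K(𝔫)`-invariant function `ψ`:
  **`∑_{y ∈ s} r(ι_w y) ψ = [K(𝔫) ι_w(t) K(𝔫)] ψ`** — the local–global coset correspondence at the
  unramified level `K_f(𝔫)` (`HeckeUnramifiedLevelLocal`, `UnramifiedLevelChange`) transported along
  `GLn.ofFinite` (`heckeOperator_comp_apply`, `GLn.ofFinite_injective`, `GLn.ofFinite_sndHom_ofLocal`);
* `exists_hasSatakeParamAt_and_sum_rightTranslation_sub_smul_mem` — under the tree's per-`π` named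
  fact `Flath1979_heckeOperator_ofLocal_sub_smul_mem` (hypothesis `hS`): at every `w ∤ 𝔫` (given a
  `K(𝔫)`-invariant `φ ∈ W ∖ W'`) there is a Satake parameter `α` with
  **`∑_{y ∈ s} r(ι_w y) ψ ≡ q_w^{j(n-j)/2} e_j(α) ψ (mod W')`** for all `K(𝔫)`-invariant `ψ ∈ W`,
  `s` a transversal for `t_{w,j}(ϖ_w)` (`AutomorphicRepsGLSatakeScalars`,
  `heckeDiagAt_eq_ofLocal_glDiagonal`, `BigHeckeGLn.valued_uniformizerAt`);
* `BigHeckeGLn.ofFinite_heckeElement` — `GLn.ofFinite (t_{w,i}) = heckeDiagAt w ϖ_w i` for all `n`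
  (the case `n = 1` is `BigHeckeGLn.ofFinite_heckeElement_one`).

The same sum `∑_{y ∈ s} r(ι_w y)`, acting on `π ⊗ E_wt(ℂ)`, computes `T_{w,j}` on the
`(𝔤, K_∞)`-cohomology of `π` (`CuspidalCohomologyHeckeLocal.heckeTWt_eq_rTensorCohomologyHom_sum`).

## References
* [Harder1987] G. Harder, *Eisenstein cohomology of arithmetic groups. The case GL₂*, §3.
* [KhareThorne2017] C. Khare, J. Thorne, Amer. J. Math. 139 (2017), §6.2.
* [FlathCorvallis1979] D. Flath, Corvallis 1979, Thm. 3.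
-/

noncomputable section

namespace Literature.NumberTheory.Automorphic

section HeckeElement

open scoped MatrixGroups
open _root_.NumberField IsDedekindDomain

variable {n : ℕ} {K : Type} [Field K] [NumberField K]

/-- The finite-adelic Hecke element `t_{v,i}` of `CompletedCohomologyHeckeAlgebraGLn` is, inside
`GL_n(𝔸_K)`, the Hecke element `heckeDiagAt` of the fixed uniformiser (all `n`; the case
`n = 1` is `BigHeckeGLn.ofFinite_heckeElement_one`). [folklore] -/
theorem BigHeckeGLn.ofFinite_heckeElement (v : HeightOneSpectrum (𝓞 K)) (i : ℕ) :
    GLn.ofFinite n K (BigHeckeGLn.heckeElement n K v i) =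
      heckeDiagAt n K v (BigHeckeGLn.uniformizerAt v) i := by
  refine Matrix.GeneralLinearGroup.ext fun a b => ?_
  rw [GLn.coe_ofFinite_apply, BigHeckeGLn.heckeElement, heckeDiagAt, coe_glDiagonal,
    coe_glDiagonal, Matrix.diagonal_apply, Matrix.diagonal_apply, Matrix.one_apply]
  by_cases hab : a = b
  · subst hab
    simp only [if_true]
    split_ifs <;> rfl
  · simp only [if_neg hab]
    rfl

end HeckeElement

namespace AutomorphicRepData

open MulAction
open scoped MatrixGroups Classical
open scoped _root_.NumberField
open _root_.NumberField IsDedekindDomain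

variable {n : ℕ} {K : Type} [Field K] [NumberField K]

/-- The finite part `K_f(𝔫) ≤ GL_n(𝔸_K^∞)` of the principal congruence subgroup maps onto `K(𝔫)`
under `GLn.ofFinite` (`K(𝔫) ≤ {1} × GL_n(𝒪̂_K)`). [folklore] -/
theorem map_ofFinite_comap_principalCongruenceLevel (𝔫 : Ideal (𝓞 K)) :
    ((principalCongruenceLevel n K 𝔫).comap (GLn.ofFinite n K)).map (GLn.ofFinite n K) =
      principalCongruenceLevel n K 𝔫 := by
  ext g
  constructor
  · intro h
    obtain ⟨u, hu, rfl⟩ := Subgroup.mem_map.1 h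
    exact hu
  · intro hg
    have hg' := GLn.ofFinite_sndHom_of_mem (principalCongruenceLevel_le n K 𝔫 hg)
    refine Subgroup.mem_map.2 ⟨GLn.sndHom n K g, ?_, hg'⟩
    rw [Subgroup.mem_comap, hg']
    exact hg

/-- A `K(𝔫)`-invariant function is fixed by `K_f(𝔫)` under the finite-adelic right translation
`r ∘ GLn.ofFinite`. [folklore] -/
theorem mem_fixedPoints_comp_ofFinite {𝔫 : Ideal (𝓞 K)} {ψ : (AdelicGroupData.gl n K).Adelic → ℂ}
    (hψ : ∀ u ∈ principalCongruenceLevel n K 𝔫, rightTranslation (AdelicGroupData.gl n K) u ψ = ψ) :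
    ψ ∈ Representation.fixedPoints
      ((rightTranslation (AdelicGroupData.gl n K)).comp (GLn.ofFinite n K))
      ((principalCongruenceLevel n K 𝔫).comap (GLn.ofFinite n K)) := by
  rw [Representation.mem_fixedPoints]
  intro u hu
  exact hψ _ hu

/-- **The sum of local translations is the classical Hecke operator.** For `𝔫 ≠ 0`, `w ∤ 𝔫`,
`t ∈ GL_n(F_w)`, a transversal `s` of `GL_n(𝒪_w) t GL_n(𝒪_w) / GL_n(𝒪_w)` and a `K(𝔫)`-invariant
function `ψ` on `GL_n(𝔸_K)`: `∑_{y ∈ s} r(ι_w y) ψ = [K(𝔫) ι_w(t) K(𝔫)] ψ` (local–global coset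
correspondence at the unramified level `K_f(𝔫)`, transported along `GLn.ofFinite`).
[cite: KhareThorne2017, §6.2] [folklore] -/
theorem sum_rightTranslation_ofLocal_eq_heckeOperator {𝔫 : Ideal (𝓞 K)} (h𝔫 : 𝔫 ≠ 0)
    {w : HeightOneSpectrum (𝓞 K)} (hw : ¬ w.asIdeal ∣ 𝔫) (t : GL (Fin n) (w.adicCompletion K))
    (s : Finset (GL (Fin n) (w.adicCompletion K)))
    (hs : Set.BijOn
      (fun y : GL (Fin n) (w.adicCompletion K) =>
        (y : GL (Fin n) (w.adicCompletion K) ⧸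
          (valuedCongruenceSubgroup (Fin n) (1 : WithZero (Multiplicative ℤ)) :
            Subgroup (GL (Fin n) (w.adicCompletion K)))))
      s (orbit (valuedCongruenceSubgroup (Fin n) (1 : WithZero (Multiplicative ℤ)) :
          Subgroup (GL (Fin n) (w.adicCompletion K)))
        (t : GL (Fin n) (w.adicCompletion K) ⧸
          (valuedCongruenceSubgroup (Fin n) (1 : WithZero (Multiplicative ℤ)) :
            Subgroup (GL (Fin n) (w.adicCompletion K))))))
    {ψ : (AdelicGroupData.gl n K).Adelic → ℂ}
    (hψ : ∀ u ∈ principalCongruenceLevel n K 𝔫, rightTranslation (AdelicGroupData.gl n K) u ψ = ψ) :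
    ∑ y ∈ s, rightTranslation (AdelicGroupData.gl n K) (GLn.ofLocal n K w y) ψ =
      heckeOperator (rightTranslation (AdelicGroupData.gl n K)) (principalCongruenceLevel n K 𝔫)
        (GLn.ofLocal n K w t) ψ := by
  set r := rightTranslation (AdelicGroupData.gl n K) with hr
  have hψf := mem_fixedPoints_comp_ofFinite (n := n) hψ
  have hU := BigHeckeGLn.isUnramifiedLevel_comap_principalCongruenceLevel (n := n) h𝔫 hw
  -- local sum at the finite-adelic level `K_f(𝔫)`
  have key1 := hU.heckeOperator_apply_eq_sum_local (r.comp (GLn.ofFinite n K)) t s hs hψf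
  -- transport along `GLn.ofFinite`
  haveI := isHeckeTriple_comap_ofFinite_principalCongruenceLevel n K h𝔫
  have hfin : (orbit ((principalCongruenceLevel n K 𝔫).comap (GLn.ofFinite n K))
      ((BigHeckeGLn.ofLocal n K w t : GL (Fin n) (FiniteAdeleRing (𝓞 K) K)) :
        GL (Fin n) (FiniteAdeleRing (𝓞 K) K) ⧸
          (principalCongruenceLevel n K 𝔫).comap (GLn.ofFinite n K))).Finite :=
    finite_orbit_quotient _ _
  have key2 := heckeOperator_comp_apply r (GLn.ofFinite n K) GLn.ofFinite_injective
    ((principalCongruenceLevel n K 𝔫).comap (GLn.ofFinite n K)) (BigHeckeGLn.ofLocal n K w t) hfin hψf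
  -- identify the transported level and element
  have e := congrArg₂
    (fun (L : Subgroup (GL (Fin n) (AdeleRing (𝓞 K) K))) (g : GL (Fin n) (AdeleRing (𝓞 K) K)) =>
      heckeOperator r L g ψ)
    (map_ofFinite_comap_principalCongruenceLevel (n := n) (K := K) 𝔫) (GLn.ofFinite_sndHom_ofLocal w t)
  have key3 : ∑ y ∈ s, r (GLn.ofLocal n K w y) ψ =
      ∑ y ∈ s, (r.comp (GLn.ofFinite n K)) (BigHeckeGLn.ofLocal n K w y) ψ :=
    Finset.sum_congr rfl fun y _ =>
      (congrArg (fun g => r g ψ) (GLn.ofFinite_sndHom_ofLocal w y)).symm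
  exact key3.trans (key1.symm.trans (key2.trans e))

variable {hcpt : isCompact_glFiniteIntegralLevel n K} (π : AutomorphicRepData (AutomorphyDatum.gl n K hcpt))

/-- **The sum of local translations acts by the Satake eigenvalue modulo `W'`.** Under the named
fact `Flath1979_heckeOperator_ofLocal_sub_smul_mem`: for `𝔫 ≠ 0`, a `K(𝔫)`-invariant `φ ∈ W ∖ W'`
and `w ∤ 𝔫` there is a Satake parameter `α` of `π` at `w` such that for every `j ≤ n`, every
transversal `s` of `GL_n(𝒪_w) t_{w,j}(ϖ_w) GL_n(𝒪_w) / GL_n(𝒪_w)` (`ϖ_w` the fixed uniformiser) and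
every `K(𝔫)`-invariant `ψ ∈ W`:
`∑_{y ∈ s} r(ι_w y) ψ ≡ q_w^{j(n-j)/2} e_j(α) ψ (mod W')`.
[cite: FlathCorvallis1979, Thm. 3] [cite: Harder1987, §3] -/
theorem exists_hasSatakeParamAt_and_sum_rightTranslation_sub_smul_mem
    (hS : π.Flath1979_heckeOperator_ofLocal_sub_smul_mem) {𝔫 : Ideal (𝓞 K)} (h𝔫 : 𝔫 ≠ 0)
    {w : HeightOneSpectrum (𝓞 K)} (hw : ¬ w.asIdeal ∣ 𝔫)
    {φ : (AdelicGroupData.gl n K).Adelic → ℂ} (hφW : φ ∈ π.W) (hφW' : φ ∉ π.W')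
    (hfix : ∀ u ∈ principalCongruenceLevel n K 𝔫,
      rightTranslation (AdelicGroupData.gl n K) u φ = φ) :
    ∃ α : Multiset ℂ, π.HasSatakeParamAt w α ∧ ∀ j ≤ n,
      ∀ (s : Finset (GL (Fin n) (w.adicCompletion K))),
        Set.BijOn
          (fun y : GL (Fin n) (w.adicCompletion K) =>
            (y : GL (Fin n) (w.adicCompletion K) ⧸
              (valuedCongruenceSubgroup (Fin n) (1 : WithZero (Multiplicative ℤ)) :
                Subgroup (GL (Fin n) (w.adicCompletion K)))))
          s (orbit (valuedCongruenceSubgroup (Fin n) (1 : WithZero (Multiplicative ℤ)) :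
              Subgroup (GL (Fin n) (w.adicCompletion K)))
            ((glDiagonal n (w.adicCompletion K) fun k =>
                if (k : ℕ) < j then BigHeckeGLn.uniformizerAt w else 1 :
                  GL (Fin n) (w.adicCompletion K)) :
              GL (Fin n) (w.adicCompletion K) ⧸
                (valuedCongruenceSubgroup (Fin n) (1 : WithZero (Multiplicative ℤ)) :
                  Subgroup (GL (Fin n) (w.adicCompletion K))))) →
        ∀ ψ ∈ π.W, (∀ u ∈ principalCongruenceLevel n K 𝔫,
            rightTranslation (AdelicGroupData.gl n K) u ψ = ψ) →
          (∑ y ∈ s, rightTranslation (AdelicGroupData.gl n K) (GLn.ofLocal n K w y) ψ) -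
            (((Real.sqrt (w.residueCard : ℝ) : ℝ) : ℂ) ^ (j * (n - j)) * α.esymm j) • ψ ∈ π.W' := by
  obtain ⟨α, hα, hT⟩ := exists_hasSatakeParamAt_and_sub_smul_mem hS h𝔫 hw
    (BigHeckeGLn.valued_uniformizerAt w) hφW hφW' hfix
  refine ⟨α, hα, fun j hj s hs ψ hψW hψfix => ?_⟩
  rw [sum_rightTranslation_ofLocal_eq_heckeOperator h𝔫 hw _ s hs hψfix,
    ← heckeDiagAt_eq_ofLocal_glDiagonal]
  exact hT j hj ψ hψW hψfix

end AutomorphicRepData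

end Literature.NumberTheory.Automorphic

end
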